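import Summits.AnomalousDissipation.AnomalousDissipation.Theorems.SolenoidalFractalHomogenisationLagrangianStepSidebandOwnSlotFrame
import Summits.AnomalousDissipation.AnomalousDissipation.Theorems.SolenoidalFractalHomogenisationLagrangianStepSidebandConjGen
import HarnessLib

/-!
# K1L_D `LagrangianRenormalisationStepDesign` (stmt-AnomalousDissipation-27980), registered stub `stub_D1_V0thg` (v28, ruling D28-3 (3)), port-map layer L4:
# the FROZEN-FRAME sideband generator, sources and feedback commute with the conjugate flip `(J y)_z = −conj(y_{−z})`
# (helper; `--supports stmt-AnomalousDissipation-27980 --as helper`)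

Summits-side helper file of route `SolenoidalFractalHomogenisation` (prover seat `ad-k1l-cellLawV-w1` g9; port map
`Cruxes/LagrangianRenormalisationStepDesign/Lines/onelevel-vtheta-twist-portmap.md` §3 L4, ruling D28-7).  The frozen-frame twin of `…SidebandConjFibre` §1 +
`…SidebandConjGen`: the twisted projections `P^θ_w = transversalProjR (twistFreq G₀ w)` have real entries and are even in `w` exactly like the flat ones, so the
whole flat conjugation algebra carries over (`conjFlip_assemble`, `feedback_conjFlip`, `symbT_neg_vec`, `conjVec_symbT`, `coordL_conjFlip`, `neg_mem_box` are flat and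
REUSED BY NAME).  Everything proved; no definitions, no named facts, no sorry.
* `conjVec_transversalProjR`, `transversalProjR_twistFreq_neg` — `conj (P_q z) = P_q (conj z)` for a real wave vector `q`; `P^θ_{−w} = P^θ_w`;
* `damping_conjFlip_frame`, `longitudinal_conjFlip_frame`, `link_conjFlip_frame` — the three pieces of `genCompθ` under the flip;
* **`sourceCompθ_conjVec`** — `(sourceθ (conj v))_z = −conj ((sourceθ v)_{−z})`; **`genCompθ_conjFlip`** — `(genθ (J y))_z = −conj ((genθ y)_{−z})`:
  the twisted truncated `ξ = 0` sideband system is REAL.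
At `G₀ = 1` these are literally the flat statements (`transversalProjR_twistFreq_one`, `genCompθ_one`, `sourceCompθ_one`).
NOT a proof of any registered stub, of the crux, or of anomalous dissipation; rung F-D1 infrastructure for the `stub_D1_V0thg` engine (`…SidebandRealFrame` next).
-/

set_option linter.dupNamespace false

noncomputable section

namespace Summit.AnomalousDissipation.AnomalousDissipation.Theorems.SolenoidalFractalHomogenisation.LagrangianStep.Sideband

open Set MeasureTheory Complex UnitAddTorus Filter Topology
open scoped InnerProductSpace ComplexConjugate
open Literature.Analysis Literature.Analysis.FunctionSpaces Literature.Analysis.FunctionSpaces.Torus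
open Literature.Analysis.FluidPDE Literature.Analysis.FluidPDE.Torus Literature.Analysis.FluidPDE.LatticeShear
open Summit.AnomalousDissipation.AnomalousDissipation.Theorems.SolenoidalFractalHomogenisation.LagrangianStep.CellChain (linkCoeff conj_linkCoeff)

variable {k₀ : ℕ}

/-! ## §1 Fibre lemmas for the twisted projection -/

/-- The twisted projection has real entries: `conj (P_q z) = P_q (conj z)` for a real wave vector `q`. [cite: Temam1984, Ch. III §1.1] -/
theorem conjVec_transversalProjR (q : Fin 3 → ℝ) (z : EuclideanSpace ℂ (Fin 3)) :
    EuclideanSpace.conjVec (transversalProjR q z) = transversalProjR q (EuclideanSpace.conjVec z) := by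
  have hw : EuclideanSpace.conjVec (waveVecRC q : EuclideanSpace ℂ (Fin 3)) = waveVecRC q := by ext i; simp
  have hr : rdot q (EuclideanSpace.conjVec z) = conj (rdot q z) := by
    simp [rdot_apply, map_sum, map_mul]
  rw [transversalProjR_apply, transversalProjR_apply, EuclideanSpace.conjVec_sub, EuclideanSpace.conjVec_smul, hw, hr, map_mul, map_inv₀,
    Complex.conj_ofReal]

/-- The twisted projection is even in the integer wave vector: `P^θ_{−k} z = P^θ_k z`. [cite: Temam1984, Ch. III §1.1] -/
theorem transversalProjR_twistFreq_neg (G₀ : Matrix (Fin 3) (Fin 3) ℝ) (k : Fin 3 → ℤ) (z : EuclideanSpace ℂ (Fin 3)) :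
    transversalProjR (twistFreq G₀ (-k)) z = transversalProjR (twistFreq G₀ k) z := by
  rw [twistFreq_neg, transversalProjR_neg]

/-! ## §2 The pieces of `genCompθ` under the flip, the twisted source and generator -/

/-- **Damping piece under the flip**: `P_w T(w) P_w (−conj v) = −conj (P_{−w} T(−w) P_{−w} v)`. [cite: Frisch1995Turbulence, §9.6.3 eq. (9.57) p. 233] -/
theorem damping_conjFlip_frame (T : Torus.Visc4 (Fin 3)) (G₀ : Matrix (Fin 3) (Fin 3) ℝ) (w : Fin 3 → ℤ) (v : EuclideanSpace ℂ (Fin 3)) :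
    transversalProjR (twistFreq G₀ w) (Torus.symbT T w (transversalProjR (twistFreq G₀ w) (-EuclideanSpace.conjVec v))) =
      -EuclideanSpace.conjVec (transversalProjR (twistFreq G₀ (-w)) (Torus.symbT T (-w) (transversalProjR (twistFreq G₀ (-w)) v))) := by
  rw [transversalProjR_twistFreq_neg G₀, symbT_neg_wave, transversalProjR_twistFreq_neg G₀, conjVec_transversalProjR, conjVec_symbT, conjVec_transversalProjR,
    map_neg, symbT_neg_vec, map_neg]

/-- **Longitudinal piece under the flip**: `(−conj v) − P_w(−conj v) = −conj (v − P_{−w} v)`. [cite: Temam1984, Ch. III §1.1] -/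
theorem longitudinal_conjFlip_frame (G₀ : Matrix (Fin 3) (Fin 3) ℝ) (w : Fin 3 → ℤ) (v : EuclideanSpace ℂ (Fin 3)) :
    (-EuclideanSpace.conjVec v) - transversalProjR (twistFreq G₀ w) (-EuclideanSpace.conjVec v) =
      -EuclideanSpace.conjVec (v - transversalProjR (twistFreq G₀ (-w)) v) := by
  rw [transversalProjR_twistFreq_neg G₀, EuclideanSpace.conjVec_sub, conjVec_transversalProjR, map_neg, neg_sub', sub_neg_eq_add]

/-- **One link under the flip**: with `c = linkCoeffⱼ`, `α = slotAmp`,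
`c(w) • P_w (α•P_{w−m}(−conj B) + ᾱ•P_{w+m}(−conj C)) = −conj (c(−w) • P_{−w} (α•P_{−w−m} C + ᾱ•P_{−w+m} B))`. [cite: MeshalkinSinai1961, pp. 1700–1705] -/
theorem link_conjFlip_frame (W₁ : LatticeWord k₀) (G₀ : Matrix (Fin 3) (Fin 3) ℝ) (j : Fin k₀) (t : ℝ) (w : Fin 3 → ℤ) (B C : EuclideanSpace ℂ (Fin 3)) :
    linkCoeff W₁ 1 w j t • transversalProjR (twistFreq G₀ w)
        (slotAmp W₁ j • transversalProjR (twistFreq G₀ (w - (W₁.phase j).m)) (-EuclideanSpace.conjVec B) +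
          conj (slotAmp W₁ j) • transversalProjR (twistFreq G₀ (w + (W₁.phase j).m)) (-EuclideanSpace.conjVec C)) =
      -EuclideanSpace.conjVec (linkCoeff W₁ 1 (-w) j t • transversalProjR (twistFreq G₀ (-w))
        (slotAmp W₁ j • transversalProjR (twistFreq G₀ (-w - (W₁.phase j).m)) C + conj (slotAmp W₁ j) • transversalProjR (twistFreq G₀ (-w + (W₁.phase j).m)) B)) := by
  have h1 : -w - (W₁.phase j).m = -(w + (W₁.phase j).m) := by abel
  have h2 : -w + (W₁.phase j).m = -(w - (W₁.phase j).m) := by abel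
  rw [h1, h2, transversalProjR_twistFreq_neg G₀, transversalProjR_twistFreq_neg G₀, transversalProjR_twistFreq_neg G₀, EuclideanSpace.conjVec_smul,
    conj_linkCoeff_neg_wave, conjVec_transversalProjR, EuclideanSpace.conjVec_add, EuclideanSpace.conjVec_smul, EuclideanSpace.conjVec_smul,
    starRingEnd_self_apply, conjVec_transversalProjR, conjVec_transversalProjR, map_neg, map_neg, smul_neg, smul_neg, ← smul_neg, map_add,
    map_add]
  simp only [smul_neg, map_neg, smul_add, neg_add]
  abel

/-- **The unit source under conjugation**: `(source (conj v))_z = −conj ((source v)_{−z})`. [cite: MajdaKramer1999, §2.2.1.3 (source term)] -/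
theorem sourceCompθ_conjVec (W₁ : LatticeWord k₀) (G₀ : Matrix (Fin 3) (Fin 3) ℝ) (R : ℕ) (j : Fin k₀) (t : ℝ) (z : box R) (v : EuclideanSpace ℂ (Fin 3)) :
    sourceCompθ W₁ G₀ R j t z (EuclideanSpace.conjVec v) = -EuclideanSpace.conjVec (sourceCompθ W₁ G₀ R j t ⟨-z.1, neg_mem_box z.2⟩ v) := by
  have hneg : ∀ m : Fin 3 → ℤ, ((-z.1 = m) ↔ (z.1 = -m)) := fun m => neg_eq_iff_eq_neg
  rw [sourceCompθ, sourceCompθ]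
  simp only [add_apply]
  have hm0 : (W₁.phase j).m ≠ 0 := (W₁.phase j).m_ne
  by_cases h1 : z.1 = (W₁.phase j).m
  · have h2 : ¬ z.1 = -(W₁.phase j).m := fun h => hm0 (by
      have := h1.symm.trans h
      have : (2:ℤ) • (W₁.phase j).m = 0 := by rw [two_zsmul]; nth_rewrite 1 [this]; simp
      exact (smul_eq_zero.1 this).resolve_left (by norm_num))
    have h3 : ¬ (-z.1) = (W₁.phase j).m := fun h => h2 ((hneg _).1 h)
    have h4 : (-z.1) = -(W₁.phase j).m := by rw [h1]
    rw [if_pos h1, if_neg h2, if_neg h3, if_pos h4, smul_apply, zero_apply, add_zero, zero_apply, zero_add, smul_apply,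
      EuclideanSpace.conjVec_smul, conjVec_transversalProjR, map_neg, map_mul, map_mul, map_mul, starRingEnd_self_apply,
      Complex.conj_ofReal, Complex.conj_I, transversalProjR_twistFreq_neg G₀, h1]
    simp only [mul_neg, neg_mul, neg_neg, neg_smul, map_mul, Complex.conj_ofReal, map_ofNat]
  · by_cases h2 : z.1 = -(W₁.phase j).m
    · have h3 : (-z.1) = (W₁.phase j).m := by rw [h2, neg_neg]
      have h4 : ¬ (-z.1) = -(W₁.phase j).m := fun h => h1 (by rw [← neg_neg z.1, h, neg_neg])
      rw [if_neg h1, if_pos h2, if_pos h3, if_neg h4, smul_apply, zero_apply, zero_add, zero_apply, add_zero, smul_apply,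
        EuclideanSpace.conjVec_smul, conjVec_transversalProjR, map_neg, map_mul, map_mul, map_mul,
        Complex.conj_ofReal, Complex.conj_I, h2, transversalProjR_twistFreq_neg G₀]
      simp only [mul_neg, neg_mul, neg_neg, neg_smul, map_mul, Complex.conj_ofReal, map_ofNat]
    · have h3 : ¬ (-z.1) = (W₁.phase j).m := fun h => h2 ((hneg _).1 h)
      have h4 : ¬ (-z.1) = -(W₁.phase j).m := fun h => h1 (by rw [← neg_neg z.1, h, neg_neg])
      rw [if_neg h1, if_neg h2, if_neg h3, if_neg h4]
      simp

/-- **THE GENERATOR COMMUTES WITH THE CONJUGATE FLIP**: `(gen (J y))_z = −conj ((gen y)_{−z})` with `(J y)_z = −conj(y_{−z})` — the truncated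
`ξ = 0` sideband system is REAL (assembly of `damping_conjFlip`, `longitudinal_conjFlip`, `link_conjFlip` by `conjFlip_assemble`; appended).
[cite: MajdaKramer1999, §2.2.1.3 (cell problem (49))] -/
theorem genCompθ_conjFlip (W₁ : LatticeWord k₀) (𝔸 : Torus.Visc4 (Fin 3)) (G₀ : Matrix (Fin 3) (Fin 3) ℝ) (γ₁ : ℝ) (R : ℕ) (t : ℝ) (z : box R) (y : Space R) :
    genCompθ W₁ 𝔸 G₀ γ₁ R t z (WithLp.toLp 2 fun z' : box R => -EuclideanSpace.conjVec (y ⟨-z'.1, neg_mem_box z'.2⟩)) =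
      -EuclideanSpace.conjVec (genCompθ W₁ 𝔸 G₀ γ₁ R t ⟨-z.1, neg_mem_box z.2⟩ y) := by
  obtain ⟨Jy, hJy⟩ : ∃ Jy : Space R, Jy = WithLp.toLp 2 (fun z' : box R => -EuclideanSpace.conjVec (y ⟨-z'.1, neg_mem_box z'.2⟩)) :=
    ⟨_, rfl⟩
  rw [← hJy]
  have hc : ∀ w, coordL R w Jy = -EuclideanSpace.conjVec (coordL R (-w) y) := fun w => by rw [hJy]; exact coordL_conjFlip y w
  have e1 : ∀ j : Fin k₀, -(z.1 - (W₁.phase j).m) = -z.1 + (W₁.phase j).m := fun j => by abel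
  have e2 : ∀ j : Fin k₀, -(z.1 + (W₁.phase j).m) = -z.1 - (W₁.phase j).m := fun j => by abel
  rw [genCompθ_apply, genCompθ_apply]
  have hsum : ∑ j, linkCoeff W₁ 1 z.1 j t • transversalProjR (twistFreq G₀ z.1)
        (slotAmp W₁ j • transversalProjR (twistFreq G₀ (z.1 - (W₁.phase j).m)) (coordL R (z.1 - (W₁.phase j).m) Jy) +
          starRingEnd ℂ (slotAmp W₁ j) • transversalProjR (twistFreq G₀ (z.1 + (W₁.phase j).m)) (coordL R (z.1 + (W₁.phase j).m) Jy)) =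
      ∑ j, -EuclideanSpace.conjVec (linkCoeff W₁ 1 (-z.1) j t • transversalProjR (twistFreq G₀ (-z.1))
        (slotAmp W₁ j • transversalProjR (twistFreq G₀ (-z.1 - (W₁.phase j).m)) (coordL R (-z.1 - (W₁.phase j).m) y) +
          starRingEnd ℂ (slotAmp W₁ j) • transversalProjR (twistFreq G₀ (-z.1 + (W₁.phase j).m)) (coordL R (-z.1 + (W₁.phase j).m) y))) := by
    refine Finset.sum_congr rfl fun j _ => ?_
    rw [hc, hc, link_conjFlip_frame, e1, e2]
  rw [hc z.1, hsum, damping_conjFlip_frame, longitudinal_conjFlip_frame]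
  convert conjFlip_assemble (k₀ := k₀) (4 * Real.pi ^ 2) γ₁
    (transversalProjR (twistFreq G₀ (-z.1)) (Torus.symbT (Torus.majorTranspose (Torus.Visc4.conj G₀ 𝔸)) (-z.1) (transversalProjR (twistFreq G₀ (-z.1)) (coordL R (-z.1) y))))
    (coordL R (-z.1) y - transversalProjR (twistFreq G₀ (-z.1)) (coordL R (-z.1) y))
    (fun j => linkCoeff W₁ 1 (-z.1) j t • transversalProjR (twistFreq G₀ (-z.1))
        (slotAmp W₁ j • transversalProjR (twistFreq G₀ (-z.1 - (W₁.phase j).m)) (coordL R (-z.1 - (W₁.phase j).m) y) +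
          starRingEnd ℂ (slotAmp W₁ j) • transversalProjR (twistFreq G₀ (-z.1 + (W₁.phase j).m)) (coordL R (-z.1 + (W₁.phase j).m) y))) using 3

end Summit.AnomalousDissipation.AnomalousDissipation.Theorems.SolenoidalFractalHomogenisation.LagrangianStep.Sideband

end
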